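import Literature.IUT.LogVolume.Corollary23Chain
import Literature.IUT.LogVolume.Corollary22PartI
import Literature.NumberTheory.LocalFields.PadicFiniteSubextensions
import HarnessLib

/-!
# [IUTchIV] Cor. 2.3, proof p. 55: the bracketed "WLOG (∗^{j-inv})" sentence — `Cor22.JInvVacuous` PROVED

Proof-only companion of `Corollary23Chain.lean` (abc-iut campaign S; statement typed by seat
abc-iut-S3; this proof by seat abc-iut-S-d3). Mochizuki, *Inter-universal Teichmüller theory IV*,
proof of Cor. 2.3 (kurims p. 55): "[… the condition “(∗^{j-inv})” … is entirely vacuous in situations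
… in which one is only concerned with `K_V ∩ U_X(ℚ̄)^{≤d}` for a fixed `d`]". As a named input of the
apex chain (`Cor22.abc_of_corollary22 : Corollary22 H → JInvVacuous → GenEll_thm21 → abc`):

> `JInvVacuous : ∀ D : CBData, D.SupportContains {2} → ∀ d, 0 < d →`
> `  ∃ D' : CBData, Hypotheses D' ∧ D.toSet ∩ UPle d ⊆ D'.toSet`.

PROOF (classical, independent of the disputed chain). Fix `K_V = D` with `2` in its support and `d`.
By the tree's **finiteness of the subextensions of `Q̄₂/ℚ₂` of degree `≤ d`**
(`Literature.NumberTheory.LocalFields.finite_setOf_intermediateField_finrank_le`, Krasner), the set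
`C := ⋃_{[E:ℚ₂] ≤ d} (K_2 ∩ X(E))` is a finite union of compact sets, hence compact, and it avoids
`λ ∈ {0, 1}`, so the `j`-invariant `j(λ) = 2^8(λ²−λ+1)³/(λ²(λ−1)²)` is bounded on it, say by `M ≥ 1`
(also `M ≥ ‖j(y₀)‖` for a chosen `y₀ ∈ K_2`). Replace `K_2` by the CLOPEN cut
`K'_2 := K_2 ∩ {‖j‖ ≤ M}`: it is nonempty, `Gal(Q̄₂/ℚ₂)`-stable (`j` commutes with field automorphisms,
which are isometries of the spectral norm), and for every finite `E/ℚ₂` the slice `K'_2 ∩ X(E)` is a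
compact DOMAIN (closed in the compact `K_2 ∩ X(E)`; since `{‖·‖ ≤ M}` is open in the ultrametric `Q̄₂`
and `j` is continuous off `{0,1}`, "closure of interior" is preserved). The new `K'_V` satisfies
(∗^{j-inv}) by construction, and every point of `K_V` of degree `≤ d` lies in `K'_V`: each conjugate
`σ(λ) ∈ Q̄₂` generates a subextension of degree `≤ [ℚ(λ):ℚ] ≤ d`, so `σ(λ) ∈ C` and `‖j(σ λ)‖ ≤ M`.

Main: `Cor22.jInvVacuous_holds : JInvVacuous`. With it `Cor22.abc_of_corollary22` has exactly two
named inputs left: `Corollary22 H_unif` (the [IUTchIV] content) and `GenEll_thm21`.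
No new definitions; nothing here takes a side on [IUTchIII] Cor. 3.12.
-/

noncomputable section

namespace Literature.IUT.LogVolume

namespace Cor22

open Literature.NumberTheory.DiophantineGeometry Literature.NumberTheory.DiophantineGeometry.GenEll
open Metric Polynomial IntermediateField

/-! ## The `j`-invariant: functoriality, continuity -/

-- `Cor22.map_jInv` (j commutes with field homomorphisms) is S3's, `Corollary22PartI.lean`.

/-- `j` is continuous on `U = {λ ≠ 0, 1}` of any normed field. [claim: Mochizuki2012, status: disputed] -/
theorem continuousOn_jInv {F : Type*} [NormedField F] :
    ContinuousOn (fun t : F => jInv t) {t | t ≠ 0 ∧ t ≠ 1} := by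
  unfold jInv
  refine ContinuousOn.div (by fun_prop) (by fun_prop) fun t ht => ?_
  exact mul_ne_zero (pow_ne_zero _ ht.1) (pow_ne_zero _ (sub_ne_zero.mpr ht.2))

section Padic

variable {p : ℕ} [Fact p.Prime]

/-- `ℚ_p`-algebra automorphisms of `Q̄_p` are isometries (the norm of `Q̄_p` is the spectral norm, a
function of the minimal polynomial, which `σ` preserves). [folklore] -/
private theorem norm_algEquiv (σ : PadicAlgCl p ≃ₐ[ℚ_[p]] PadicAlgCl p) (z : PadicAlgCl p) :
    ‖σ z‖ = ‖z‖ := by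
  rw [← PadicAlgCl.spectralNorm_eq p z, ← PadicAlgCl.spectralNorm_eq p (σ z)]
  unfold spectralNorm
  rw [minpoly.algEquiv_eq σ z]

/-- A conjugate `σ(x) ∈ Q̄_p` of a point `x` of a number field `F` with `[F:ℚ] ≤ d` lies in a subextension
of `Q̄_p/ℚ_p` of degree `≤ d` (namely `ℚ_p(σ x)`, whose degree is that of the minimal polynomial of
`σ x` over `ℚ_p`, a divisor of the minimal polynomial of `x` over `ℚ`). [folklore] -/
private theorem exists_intermediateField_of_ringHom (P : NFPoint) {d : ℕ} (hd : P.degree ≤ d)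
    (σ : P.F →+* PadicAlgCl p) :
    ∃ E : IntermediateField ℚ_[p] (PadicAlgCl p), FiniteDimensional ℚ_[p] E ∧
      Module.finrank ℚ_[p] E ≤ d ∧ σ P.x ∈ E := by
  set y : PadicAlgCl p := σ P.x with hy
  have hint : IsIntegral ℚ_[p] y := Algebra.IsIntegral.isIntegral y
  have hxint : IsIntegral ℚ P.x := Algebra.IsIntegral.isIntegral P.x
  set m : ℚ[X] := minpoly ℚ P.x with hm
  have hmdeg : m.natDegree ≤ d := (minpoly.natDegree_le (A := ℚ) P.x).trans hd
  -- `σ x` is a root of `m`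
  have hroot : aeval y (m.map (algebraMap ℚ ℚ_[p])) = 0 := by
    rw [aeval_map_algebraMap, hy]
    have h := Polynomial.aeval_algHom_apply (σ.toRatAlgHom) P.x m
    simp only [RingHom.toRatAlgHom_apply] at h
    rw [h, hm, minpoly.aeval, map_zero]
  have hmon : (m.map (algebraMap ℚ ℚ_[p])).Monic := (minpoly.monic hxint).map _
  have hdeg : (minpoly ℚ_[p] y).natDegree ≤ d := by
    have h1 : (minpoly ℚ_[p] y).natDegree ≤ (m.map (algebraMap ℚ ℚ_[p])).natDegree :=
      natDegree_le_natDegree (minpoly.min ℚ_[p] y hmon hroot)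
    rw [natDegree_map] at h1
    exact h1.trans hmdeg
  haveI : FiniteDimensional ℚ_[p] ℚ_[p]⟮y⟯ := adjoin.finiteDimensional hint
  refine ⟨ℚ_[p]⟮y⟯, inferInstance, ?_, mem_adjoin_simple_self ℚ_[p] y⟩
  rw [adjoin.finrank hint]
  exact hdeg

end Padic

/-! ## The clopen cut of `K_2` -/

/-- **The shrunken compactly bounded subset.** Given `K_V = D`, a bound `M ≥ 1` and a
point `y₀ ∈ K_2` with `‖j(y₀)‖ ≤ M`, the data `K'_V` obtained by replacing `K_2` with the clopen cut
`K_2 ∩ {‖j‖ ≤ M}` (all other bounding domains unchanged) is again a compactly bounded subset.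
[claim: Mochizuki2012, status: disputed] -/
theorem exists_cbData_cut (D : CBData) {M : ℝ} (hM : 1 ≤ M)
    {y₀ : PadicAlgCl 2} (hy₀ : y₀ ∈ D.Knon 2) (hy₀M : ‖jInv y₀‖ ≤ M) :
    ∃ D' : CBData, D'.primes = D.primes ∧ D'.Karc = D.Karc ∧
      (∀ (q : ℕ) [Fact q.Prime], D'.Knon q = {y | y ∈ D.Knon q ∧ (q = 2 → ‖jInv y‖ ≤ M)}) := by
  classical
  refine ⟨{ D with
    Knon := fun q _ => {y | y ∈ D.Knon q ∧ (q = 2 → ‖jInv y‖ ≤ M)}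
    Knon_nonempty := ?_
    Knon_galois := ?_
    Knon_compactDomain := ?_
    Knon_subset := ?_ }, rfl, rfl, fun q _ => rfl⟩
  · -- nonempty
    intro q hq _
    by_cases h : q = 2
    · subst h
      exact ⟨y₀, hy₀, fun _ => hy₀M⟩
    · obtain ⟨y, hy⟩ := D.Knon_nonempty q hq
      exact ⟨y, hy, fun h' => absurd h' h⟩
  · -- Galois-stable
    intro q hq _ σ y hy
    refine ⟨D.Knon_galois q hq σ y hy.1, fun h => ?_⟩
    have h1 : jInv (σ y) = σ (jInv y) := (map_jInv (σ : PadicAlgCl q →+* PadicAlgCl q) y).symm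
    rw [h1, norm_algEquiv]
    exact hy.2 h
  · -- compact domain in every finite `E`
    intro q hq _ E hE
    by_cases h : q = 2
    · subst h
      obtain ⟨hc, hdom⟩ := D.Knon_compactDomain 2 hq E hE
      -- `A = K_2 ∩ X(E)`, `V = U(E)`, `f = j` on `E`, `U = V ∩ {‖j‖ ≤ M}` (open), `B = A ∩ U`
      set A : Set E := {y : E | (y : PadicAlgCl 2) ∈ D.Knon 2} with hA
      set V : Set E := {y : E | (y : PadicAlgCl 2) ≠ 0 ∧ (y : PadicAlgCl 2) ≠ 1} with hV
      set f : E → PadicAlgCl 2 := fun y => jInv (y : PadicAlgCl 2) with hf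
      have hfV : ContinuousOn f V :=
        continuousOn_jInv.comp continuous_subtype_val.continuousOn fun y hy => hy
      have hVopen : IsOpen V := by
        have : V = Subtype.val ⁻¹' ({z : PadicAlgCl 2 | z ≠ 0} ∩ {z | z ≠ 1}) := by
          ext y; simp [hV]
        rw [this]
        exact (isOpen_ne.inter isOpen_ne).preimage continuous_subtype_val
      have hAV : A ⊆ V := fun y hy => D.Knon_subset 2 hq hy
      set U : Set E := V ∩ f ⁻¹' closedBall 0 M with hU
      have hUopen : IsOpen U :=
        hfV.isOpen_inter_preimage hVopen
          (IsUltrametricDist.isOpen_closedBall 0 (zero_lt_one.trans_le hM).ne')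
      have hBeq : {y : E | (y : PadicAlgCl 2) ∈
          {z : PadicAlgCl 2 | z ∈ D.Knon 2 ∧ (2 = 2 → ‖jInv z‖ ≤ M)}} = A ∩ U := by
        ext y
        simp only [Set.mem_setOf_eq, Set.mem_inter_iff, Set.mem_preimage, mem_closedBall_zero_iff,
          forall_const, hA, hU, hf]
        constructor
        · rintro ⟨hyA, hyM⟩
          exact ⟨hyA, hAV hyA, hyM⟩
        · rintro ⟨hyA, -, hyM⟩
          exact ⟨hyA, hyM⟩
      have hAclosed : IsClosed A := hc.isClosed
      have hBclosed : IsClosed (A ∩ U) := by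
        have h1 : A ∩ U = A ∩ f ⁻¹' closedBall 0 M := by
          ext y
          simp only [Set.mem_inter_iff, hU]
          constructor
          · rintro ⟨hyA, -, hyM⟩; exact ⟨hyA, hyM⟩
          · rintro ⟨hyA, hyM⟩; exact ⟨hyA, hAV hyA, hyM⟩
        rw [h1]
        exact (hfV.mono hAV).preimage_isClosed_of_isClosed hAclosed isClosed_closedBall
      rw [hBeq]
      refine ⟨hc.of_isClosed_subset hBclosed Set.inter_subset_left, ?_⟩
      apply Set.Subset.antisymm
      · calc closure (interior (A ∩ U)) ⊆ closure (A ∩ U) := closure_mono interior_subset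
          _ = A ∩ U := hBclosed.closure_eq
      · intro x hx
        have hxU : x ∈ U := hx.2
        have hxA : x ∈ closure (interior A) := by rw [hdom]; exact hx.1
        have h1 : x ∈ closure (U ∩ interior A) := hUopen.inter_closure ⟨hxU, hxA⟩
        rw [interior_inter, hUopen.interior_eq, Set.inter_comm]
        exact h1
    · have hset : {y : E | (y : PadicAlgCl q) ∈
          {z : PadicAlgCl q | z ∈ D.Knon q ∧ (q = 2 → ‖jInv z‖ ≤ M)}} =
          {y : E | (y : PadicAlgCl q) ∈ D.Knon q} := by
        ext y; simp [h]
      rw [hset]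
      exact D.Knon_compactDomain q hq E hE
  · -- inside `U`
    intro q hq _ y hy
    exact D.Knon_subset q hq hy.1

/-! ## The uniform bound on `j` over the points of degree `≤ d` -/

/-- **`j` is bounded on the degree-`≤ d` part of `K_2`.** For `K_V = D` with `2 ∈ Supp` and every `d`
there is `M ≥ 1` with `‖j(y)‖ ≤ M` for every `y ∈ K_2` lying in a subextension of `Q̄₂/ℚ₂` of degree
`≤ d` — by the finiteness of such subextensions (tree, Krasner) and the compactness of each
`K_2 ∩ X(E)`. [claim: Mochizuki2012, status: disputed] -/
theorem exists_bound_jInv (D : CBData) (h2 : 2 ∈ D.primes) (d : ℕ) :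
    ∃ M : ℝ, 1 ≤ M ∧ ∀ y ∈ D.Knon 2,
      (∃ E : IntermediateField ℚ_[2] (PadicAlgCl 2), FiniteDimensional ℚ_[2] E ∧
        Module.finrank ℚ_[2] E ≤ d ∧ y ∈ E) → ‖jInv y‖ ≤ M := by
  have hfin := Literature.NumberTheory.LocalFields.finite_setOf_intermediateField_finrank_le 2 d
  set C : Set (PadicAlgCl 2) :=
    ⋃ E ∈ {E : IntermediateField ℚ_[2] (PadicAlgCl 2) | FiniteDimensional ℚ_[2] E ∧
        Module.finrank ℚ_[2] E ≤ d},
      Subtype.val '' {y : E | (y : PadicAlgCl 2) ∈ D.Knon 2} with hC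
  have hCc : IsCompact C := by
    refine hfin.isCompact_biUnion fun E hE => ?_
    exact (D.Knon_compactDomain 2 h2 E hE.1).1.image continuous_subtype_val
  have hCsub : C ⊆ {t : PadicAlgCl 2 | t ≠ 0 ∧ t ≠ 1} := by
    intro t ht
    simp only [hC, Set.mem_iUnion, Set.mem_image, Set.mem_setOf_eq] at ht
    obtain ⟨E, -, y, hy, rfl⟩ := ht
    exact D.Knon_subset 2 h2 hy
  obtain ⟨M₀, hM₀⟩ := hCc.exists_bound_of_continuousOn (continuousOn_jInv.mono hCsub)
  refine ⟨max M₀ 1, le_max_right _ _, fun y hy ⟨E, hE, hEd, hyE⟩ => ?_⟩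
  have hyC : y ∈ C := by
    simp only [hC, Set.mem_iUnion, Set.mem_image, Set.mem_setOf_eq]
    exact ⟨E, ⟨hE, hEd⟩, ⟨y, hyE⟩, hy, rfl⟩
  exact (hM₀ y hyC).trans (le_max_left _ _)

/-! ## The discharge -/

/-- **[IUTchIV] Cor. 2.3, proof p. 55, the "WLOG (∗^{j-inv})" sentence** — `Cor22.JInvVacuous` HOLDS:
for every compactly bounded `K_V` whose support contains `2` and every `d ≥ 1` there is a compactly
bounded `K'_V` satisfying the hypotheses of Cor. 2.2 (`2 ∈ Supp`, (∗^{j-inv})) with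
`K_V ∩ U_X(ℚ̄)^{≤d} ⊆ K'_V` (the clopen cut `K'_2 = K_2 ∩ {‖j‖ ≤ M_d}`). PROVED — classical, via the
finiteness of the subextensions of `Q̄₂/ℚ₂` of bounded degree. [claim: Mochizuki2012, status: disputed] -/
theorem jInvVacuous_holds : JInvVacuous := by
  intro D hD d _
  have h2 : 2 ∈ D.primes := hD (Finset.mem_singleton_self 2)
  obtain ⟨M₁, hM₁, hbound⟩ := exists_bound_jInv D h2 d
  obtain ⟨y₀, hy₀⟩ := D.Knon_nonempty 2 h2
  set M : ℝ := max M₁ ‖jInv y₀‖ with hMdef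
  have hM : 1 ≤ M := hM₁.trans (le_max_left _ _)
  obtain ⟨D', hprimes, hKarc, hKnon⟩ := exists_cbData_cut D hM hy₀ (le_max_right _ _)
  refine ⟨D', ⟨?_, ?_⟩, ?_⟩
  · -- `2 ∈ Supp(K'_V)`
    intro q hq
    rw [hprimes]
    exact hD hq
  · -- (∗^{j-inv}) by construction
    refine ⟨M, fun y hy => ?_⟩
    rw [hKnon 2] at hy
    exact hy.2 rfl
  · -- the degree-`≤ d` points of `K_V` lie in `K'_V`
    rintro P ⟨hPD, hPd⟩
    refine ⟨fun σ => hKarc ▸ hPD.1 σ, fun q hq _ σ => ?_⟩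
    rw [hprimes] at hq
    rw [hKnon q]
    refine ⟨hPD.2 q hq σ, fun hq2 => ?_⟩
    subst hq2
    refine (hbound _ (hPD.2 2 hq σ) (exists_intermediateField_of_ringHom P hPd.2 σ)).trans
      (le_max_left _ _)

/-- `JInvVacuous` — `_holds` alias of `jInvVacuous_holds` above under the fact's exact name (appended
2026-08-28, D-0026 bookkeeping: the proof term is the existing theorem of this file; no statement,
definition or attribute is edited; no new named fact; the ledger's debt table listed the fact
unproved). [claim: Mochizuki2012, status: disputed] -/
theorem _root_.Literature.IUT.LogVolume.Cor22.JInvVacuous_holds : JInvVacuous :=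
  _root_.Literature.IUT.LogVolume.Cor22.jInvVacuous_holds

end Cor22

end Literature.IUT.LogVolume

end
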